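import Mathlib
import Summits.Ventures.HodgeRepro.Tier4.Line1.RtfGeometric

/-!
# Tier4/Line1/OrbitalTools — LINE L1, J2.c′ rung (c′.0) and the orbital-term toolkit

Blind re-derivation cell `pub-hodge-repro`, Tier 4 «prove the step» (README §9–§10), seat t4-L1-p2 (prover, gen 0),
LINE L1 (t4-plan-1), assignment S12232: J2.c′ `Setting.exists_pair_orbital_ne_zero` (the analytic half of the heart),
cut into the rungs of S12304.  This module: (c′.0) `finite_hit_closure` (uniform finiteness of the rational points
reaching a compact set from `closure DT × closure DT'`), the FINITE MODEL of a partial kernel on the closures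
(`partialKernel_eq_sum`, `continuous_model`), the integrability of the orbital integrands
(`integrableOn_orbital_integrand(_closure)`, `integrableOn_orbital_inner(_closure)` — the tube-lemma continuity of
`RtfGeometric`), and the `‖·‖_∞`-LIPSCHITZ ESTIMATE for the orbital term (`norm_orbital_sub_le`:
`‖O_o(f) − O_o(f')‖ ≤ #Γ · ‖f − f'‖_∞ · μT(DT) · μT'(DT')` for `f`, `f'` vanishing at `t⁻¹ γ t'` off a common finset
`Γ`).  Imports Mathlib + `RtfGeometric` (p663290) only; no countability, local compactness or Hausdorffness of `G`.

Nothing here says anything about the status of the Hodge conjecture for CM abelian varieties, which is NOT proved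
(HC_CM is NOT proved by anyone in this repository).
-/

set_option autoImplicit false

noncomputable section

/-! ## OrbitalTools — finite models of the partial kernels, integrability of the orbital integrands, the
`‖·‖_∞`-Lipschitz estimate for the orbital term (t4-L1-p2, for J2.c′) -/

namespace Summit.Ventures.HodgeRepro.Tier4.Line1.RTF

open MeasureTheory Topology Filter Set
open scoped Pointwise

variable {G : Type} [Group G] [TopologicalSpace G] [IsTopologicalGroup G] [MeasurableSpace G]
  [BorelSpace G]

namespace Setting

variable (S : Setting G)

omit [BorelSpace G] in
/-- (c′.0) UNIFORM finiteness against a compact set: the rational `γ` with `t⁻¹ γ t' ∈ M` for some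
`t ∈ closure DT`, `t' ∈ closure DT'` are finitely many (`M ⊆ G` compact): they lie in
`closure DT · M · (closure DT')⁻¹`, compact, and `G(k)` is closed and discrete. -/
theorem finite_hit_closure {M : Set G} (hM : IsCompact M) :
    {γ : S.Gk | ∃ t ∈ closure S.DT, ∃ t' ∈ closure S.DT', (t : G)⁻¹ * γ * t' ∈ M}.Finite := by
  have hA : IsCompact ((fun t : S.T => (t : G)) '' closure S.DT) :=
    S.compT.image continuous_subtype_val
  have hB : IsCompact ((fun t : S.T' => (t : G)) '' closure S.DT') :=
    S.compT'.image continuous_subtype_val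
  have hC : IsCompact (((fun t : S.T => (t : G)) '' closure S.DT) * M *
      ((fun t : S.T' => (t : G)) '' closure S.DT')⁻¹) := (hA.mul hM).mul hB.inv
  have hfin : ((S.Gk : Set G) ∩ (((fun t : S.T => (t : G)) '' closure S.DT) * M *
      ((fun t : S.T' => (t : G)) '' closure S.DT')⁻¹)).Finite :=
    (hC.inter_left S.closed).finite
      ((SetLike.isDiscrete_iff_discreteTopology.2 S.discrete).mono inter_subset_left)
  refine Set.Finite.of_finite_image (f := fun γ : S.Gk => (γ : G)) (hfin.subset ?_)
    (Set.injOn_of_injective Subtype.val_injective)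
  rintro _ ⟨γ, ⟨t, ht, t', ht', hmem⟩, rfl⟩
  refine ⟨γ.2, ?_⟩
  have hγ : (γ : G) = (t : G) * ((t : G)⁻¹ * γ * t') * ((t' : G))⁻¹ := by group
  change (γ : G) ∈ _
  rw [hγ]
  exact Set.mul_mem_mul (Set.mul_mem_mul ⟨t, ht, rfl⟩ hmem) (Set.inv_mem_inv.2 ⟨t', ht', rfl⟩)

omit [BorelSpace G] in
/-- a function supported in the compact `M` vanishes at `t⁻¹ γ t'` for `γ` outside the finite set of (c′.0). -/
theorem eq_zero_of_notMem_hit {M : Set G} (hM : IsCompact M) {f : G → ℂ} (hfM : tsupport f ⊆ M)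
    {γ : S.Gk} (hγ : γ ∉ (S.finite_hit_closure hM).toFinset) {t : S.T} (ht : t ∈ closure S.DT)
    {t' : S.T'} (ht' : t' ∈ closure S.DT') : f ((t : G)⁻¹ * γ * t') = 0 := by
  by_contra hne
  apply hγ
  rw [Set.Finite.mem_toFinset]
  exact ⟨t, ht, t', ht', hfM (subset_tsupport _ hne)⟩

omit [IsTopologicalGroup G] [BorelSpace G] in
open Classical in
/-- THE FINITE MODEL of a partial kernel on `closure DT × closure DT'`: if `f` vanishes at `t⁻¹ γ t'` for
`γ ∉ Γ` (a finset), the partial kernel of `o` is the finite sum over the fibre of `Γ` above `o`. -/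
theorem partialKernel_eq_sum {f : G → ℂ} {Γ : Finset S.Gk}
    (hΓ : ∀ γ : S.Gk, γ ∉ Γ → ∀ t ∈ closure S.DT, ∀ t' ∈ closure S.DT', f ((t : G)⁻¹ * γ * t') = 0)
    (o : S.Orbit) {t : S.T} (ht : t ∈ closure S.DT) {t' : S.T'} (ht' : t' ∈ closure S.DT') :
    S.partialKernel o f t t' = ∑ γ ∈ Γ with S.orbitOf γ = o, f ((t : G)⁻¹ * γ * t') := by
  unfold partialKernel
  rw [tsum_eq_sum (s := Γ.subtype (fun γ => S.orbitOf γ = o))]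
  · exact Finset.sum_subtype_eq_sum_filter (fun γ : S.Gk => f ((t : G)⁻¹ * γ * t'))
  · intro γ hγ
    rw [Finset.mem_subtype] at hγ
    exact hΓ γ.1 hγ t ht t' ht'

omit [BorelSpace G] in
/-- the finite model is jointly continuous in `(t, t')` -/
theorem continuous_model {f : G → ℂ} (hf : Continuous f) (Γ : Finset S.Gk) {χ : S.T → ℂ}
    {χ' : S.T' → ℂ} (hχ : Continuous χ) (hχ' : Continuous χ') :
    Continuous (Function.uncurry fun (t : S.T) (t' : S.T') =>
      (∑ γ ∈ Γ, f ((t : G)⁻¹ * γ * t')) * χ t * starRingEnd ℂ (χ' t')) := by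
  have hcont : ∀ γ : S.Gk, Continuous fun p : S.T × S.T' => f ((p.1 : G)⁻¹ * γ * p.2) := fun γ =>
    hf.comp (((continuous_subtype_val.comp continuous_fst).inv.mul continuous_const).mul
      (continuous_subtype_val.comp continuous_snd))
  apply Continuous.mul
  · apply Continuous.mul
    · exact continuous_finsetSum _ (fun γ _ => hcont γ)
    · exact hχ.comp continuous_fst
  · exact (continuous_star : Continuous (starRingEnd ℂ)).comp (hχ'.comp continuous_snd)

open Classical in
/-- INNER integrability on the CLOSURE: for `t ∈ closure DT` the orbital integrand
`t' ↦ K_f^o(t, t') χ(t) conj χ'(t')` is integrable on `closure DT'` (it agrees there with a continuous function). -/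
theorem integrableOn_orbital_integrand_closure {f : G → ℂ} (hf : IsTest f) {χ : S.T → ℂ}
    {χ' : S.T' → ℂ} (hχ : Continuous χ) (hχ' : Continuous χ') (o : S.Orbit) {t : S.T}
    (ht : t ∈ closure S.DT) :
    IntegrableOn (fun t' : S.T' => S.partialKernel o f t t' * χ t * starRingEnd ℂ (χ' t'))
      (closure S.DT') S.μT' := by
  haveI : IsFiniteMeasureOnCompacts S.μT' := S.haarT'.toIsFiniteMeasureOnCompacts
  set Γ : Finset S.Gk := (S.finite_hit_closure hf.compact).toFinset with hΓdef
  have hΓ : ∀ γ : S.Gk, γ ∉ Γ → ∀ t ∈ closure S.DT, ∀ t' ∈ closure S.DT',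
      f ((t : G)⁻¹ * γ * t') = 0 := fun γ hγ t ht t' ht' =>
    S.eq_zero_of_notMem_hit hf.compact subset_rfl hγ ht ht'
  have hc : Continuous fun t' : S.T' =>
      (∑ γ ∈ Γ with S.orbitOf γ = o, f ((t : G)⁻¹ * γ * t')) * χ t * starRingEnd ℂ (χ' t') :=
    (S.continuous_model hf.cont (Γ.filter (fun γ => S.orbitOf γ = o)) hχ hχ').uncurry_left t
  refine (hc.continuousOn.integrableOn_compact' S.compT' isClosed_closure.measurableSet).congr_fun
    ?_ isClosed_closure.measurableSet
  intro t' ht'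
  simp only [S.partialKernel_eq_sum hΓ o ht ht']

/-- INNER integrability: for `t ∈ closure DT` the orbital integrand is integrable on `DT'`. -/
theorem integrableOn_orbital_integrand {f : G → ℂ} (hf : IsTest f) {χ : S.T → ℂ} {χ' : S.T' → ℂ}
    (hχ : Continuous χ) (hχ' : Continuous χ') (o : S.Orbit) {t : S.T} (ht : t ∈ closure S.DT) :
    IntegrableOn (fun t' : S.T' => S.partialKernel o f t t' * χ t * starRingEnd ℂ (χ' t'))
      S.DT' S.μT' :=
  (S.integrableOn_orbital_integrand_closure hf hχ hχ' o ht).mono_set subset_closure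

open Classical in
/-- OUTER integrability on the CLOSURE: `t ↦ ∫_{DT'} K_f^o(t, t') χ(t) conj χ'(t')` is integrable on
`closure DT` (it agrees there with a continuous function — the parametric integral of the continuous model,
continuous by the tube lemma). -/
theorem integrableOn_orbital_inner_closure {f : G → ℂ} (hf : IsTest f) {χ : S.T → ℂ} {χ' : S.T' → ℂ}
    (hχ : Continuous χ) (hχ' : Continuous χ') (o : S.Orbit) :
    IntegrableOn (fun t : S.T =>
      ∫ t' in S.DT', S.partialKernel o f t t' * χ t * starRingEnd ℂ (χ' t') ∂S.μT')
      (closure S.DT) S.μT := by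
  haveI : IsFiniteMeasureOnCompacts S.μT := S.haarT.toIsFiniteMeasureOnCompacts
  haveI : IsFiniteMeasureOnCompacts S.μT' := S.haarT'.toIsFiniteMeasureOnCompacts
  set Γ : Finset S.Gk := (S.finite_hit_closure hf.compact).toFinset with hΓdef
  have hΓ : ∀ γ : S.Gk, γ ∉ Γ → ∀ t ∈ closure S.DT, ∀ t' ∈ closure S.DT',
      f ((t : G)⁻¹ * γ * t') = 0 := fun γ hγ t ht t' ht' =>
    S.eq_zero_of_notMem_hit hf.compact subset_rfl hγ ht ht'
  have hc : Continuous fun t : S.T => ∫ t' in S.DT',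
      (∑ γ ∈ Γ with S.orbitOf γ = o, f ((t : G)⁻¹ * γ * t')) * χ t * starRingEnd ℂ (χ' t') ∂S.μT' :=
    Geometric.continuous_setIntegral_of_continuous_uncurry S.compT'
      (S.continuous_model hf.cont (Γ.filter (fun γ => S.orbitOf γ = o)) hχ hχ')
  refine (hc.continuousOn.integrableOn_compact' S.compT isClosed_closure.measurableSet).congr_fun
    ?_ isClosed_closure.measurableSet
  intro t ht
  apply Geometric.setIntegral_congr_of_eqOn_closure
  intro t' ht'
  simp only [S.partialKernel_eq_sum hΓ o ht ht']

/-- OUTER integrability: `t ↦ ∫_{DT'} K_f^o(t, t') χ(t) conj χ'(t')` is integrable on `DT`. -/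
theorem integrableOn_orbital_inner {f : G → ℂ} (hf : IsTest f) {χ : S.T → ℂ} {χ' : S.T' → ℂ}
    (hχ : Continuous χ) (hχ' : Continuous χ') (o : S.Orbit) :
    IntegrableOn (fun t : S.T =>
      ∫ t' in S.DT', S.partialKernel o f t t' * χ t * starRingEnd ℂ (χ' t') ∂S.μT') S.DT S.μT :=
  (S.integrableOn_orbital_inner_closure hf hχ hχ' o).mono_set subset_closure

omit [IsTopologicalGroup G] [BorelSpace G] in
/-- the orbital term as the iterated integral (definitional; recorded for rewriting) -/
theorem orbital_def (χ : S.T → ℂ) (χ' : S.T' → ℂ) (o : S.Orbit) (f : G → ℂ) :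
    S.orbital χ χ' o f = ∫ t in S.DT, ∫ t' in S.DT',
      S.partialKernel o f t t' * χ t * starRingEnd ℂ (χ' t') ∂S.μT' ∂S.μT := rfl

open Classical in
/-- THE LIPSCHITZ ESTIMATE: for two test functions vanishing at `t⁻¹ γ t'` (`t ∈ closure DT`,
`t' ∈ closure DT'`) for `γ` outside a common finset `Γ`, with `‖f − f'‖_∞ ≤ η` and unitary `χ`, `χ'`,
`‖O_o(f) − O_o(f')‖ ≤ #Γ · η · μT(DT) · μT'(DT')`. -/
theorem norm_orbital_sub_le {χ : S.T → ℂ} {χ' : S.T' → ℂ} (hχ : S.IsCharacter χ)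
    (hχ' : S.IsCharacter' χ') (o : S.Orbit) {f f' : G → ℂ} (hf : IsTest f) (hf' : IsTest f')
    {Γ : Finset S.Gk}
    (hΓ : ∀ γ : S.Gk, γ ∉ Γ → ∀ t ∈ closure S.DT, ∀ t' ∈ closure S.DT', f ((t : G)⁻¹ * γ * t') = 0)
    (hΓ' : ∀ γ : S.Gk, γ ∉ Γ → ∀ t ∈ closure S.DT, ∀ t' ∈ closure S.DT', f' ((t : G)⁻¹ * γ * t') = 0)
    {η : ℝ} (hη : ∀ g, ‖f g - f' g‖ ≤ η) :
    ‖S.orbital χ χ' o f - S.orbital χ χ' o f'‖ ≤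
      (Γ.card : ℝ) * η * S.μT.real S.DT * S.μT'.real S.DT' := by
  haveI : IsFiniteMeasureOnCompacts S.μT := S.haarT.toIsFiniteMeasureOnCompacts
  haveI : IsFiniteMeasureOnCompacts S.μT' := S.haarT'.toIsFiniteMeasureOnCompacts
  have hη0 : 0 ≤ η := le_trans (norm_nonneg _) (hη 1)
  -- the pointwise bound on the difference of the integrands, on the closures
  have hpt : ∀ t ∈ closure S.DT, ∀ t' ∈ closure S.DT',
      ‖S.partialKernel o f t t' * χ t * starRingEnd ℂ (χ' t') -
        S.partialKernel o f' t t' * χ t * starRingEnd ℂ (χ' t')‖ ≤ (Γ.card : ℝ) * η := by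
    intro t ht t' ht'
    rw [S.partialKernel_eq_sum hΓ o ht ht', S.partialKernel_eq_sum hΓ' o ht ht']
    rw [← sub_mul, ← sub_mul, ← Finset.sum_sub_distrib, norm_mul, norm_mul, hχ.unit, RCLike.norm_conj,
      hχ'.unit, mul_one, mul_one]
    calc ‖∑ γ ∈ Γ with S.orbitOf γ = o, (f ((t : G)⁻¹ * γ * t') - f' ((t : G)⁻¹ * γ * t'))‖
        ≤ ∑ γ ∈ Γ with S.orbitOf γ = o, ‖f ((t : G)⁻¹ * γ * t') - f' ((t : G)⁻¹ * γ * t')‖ :=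
          norm_sum_le _ _
      _ ≤ ∑ γ ∈ Γ with S.orbitOf γ = o, η := Finset.sum_le_sum (fun γ _ => hη _)
      _ = ((Γ.filter (fun γ => S.orbitOf γ = o)).card : ℝ) * η := by
          rw [Finset.sum_const, nsmul_eq_mul]
      _ ≤ (Γ.card : ℝ) * η := by
          apply mul_le_mul_of_nonneg_right _ hη0
          exact_mod_cast Finset.card_filter_le _ _
  -- the inner difference
  have hinner : ∀ t ∈ closure S.DT,
      ‖(∫ t' in S.DT', S.partialKernel o f t t' * χ t * starRingEnd ℂ (χ' t') ∂S.μT') -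
        ∫ t' in S.DT', S.partialKernel o f' t t' * χ t * starRingEnd ℂ (χ' t') ∂S.μT'‖ ≤
        (Γ.card : ℝ) * η * S.μT'.real S.DT' := by
    intro t ht
    rw [← integral_sub (S.integrableOn_orbital_integrand hf hχ.cont hχ'.cont o ht)
      (S.integrableOn_orbital_integrand hf' hχ.cont hχ'.cont o ht)]
    exact norm_setIntegral_le_of_norm_le_const
      ((measure_mono subset_closure).trans_lt S.compT'.measure_lt_top)
      (fun t' ht' => hpt t ht t' (subset_closure ht'))
  rw [orbital_def, orbital_def,
    ← integral_sub (S.integrableOn_orbital_inner hf hχ.cont hχ'.cont o)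
      (S.integrableOn_orbital_inner hf' hχ.cont hχ'.cont o)]
  calc ‖∫ t in S.DT, ((∫ t' in S.DT', S.partialKernel o f t t' * χ t * starRingEnd ℂ (χ' t') ∂S.μT') -
        ∫ t' in S.DT', S.partialKernel o f' t t' * χ t * starRingEnd ℂ (χ' t') ∂S.μT') ∂S.μT‖
      ≤ (Γ.card : ℝ) * η * S.μT'.real S.DT' * S.μT.real S.DT :=
        norm_setIntegral_le_of_norm_le_const
          ((measure_mono subset_closure).trans_lt S.compT.measure_lt_top)
          (fun t ht => hinner t (subset_closure ht))
    _ = (Γ.card : ℝ) * η * S.μT.real S.DT * S.μT'.real S.DT' := by ring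

end Setting

end Summit.Ventures.HodgeRepro.Tier4.Line1.RTF

end
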